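import Mathlib
import HarnessLib

/-!
# Route `BECRewardDescent`, support item `WalkGlue` (stmt-AtomisticToContinuum-12880) — the
# convex-analysis skeleton of the reward walk, I: convexity from second symmetric differences

Helper file (does not close the item). `WalkGlue := RewardScaleChord → SectorGap →
CondensateVariance → RewardChordBound` is, at fixed `(v, ρ, N)`, a statement about the concave
reward curve `R(s) = inf_Ψ (⟨Ψ,HΨ⟩ + s·n₊(Ψ))`: the chord slopes `chord(s) = (R(s) - R(0))/s` satisfy
`chord(s) ≤ chord(s₀) + τN` on `(0, s₀]` as soon as, along `(0, s₀)`, the second-order response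
`-R''` is bounded by an integrable susceptibility `2K(u)` (`= 2·Var/Δ ≤ 2CN/(c√(ρa u))`) wherever the
ground state is condensed (bootstrap), the rewarded ground state is unique (`R` differentiable), and
the reward-scale rung bounds `chord(s₀)`. In the tree's variational vocabulary `R` has no second
derivative: what the Temple/Kato lower bound `R(u ± h) ≥ R(u) ± hR'(u) - K h²` delivers is a
POINTWISE lower bound on second symmetric differences, valid only for `h < h₀(u)` with no uniformity
in `u`. This file proves the real-analysis facts that turn such pointwise bounds into the integrated
derivative drop, with NO spectral input:

* `convexOn_Icc_of_symmDiff_pos`, `convexOn_Icc_of_symmDiff` — **generalised Schwarz convexity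
  criterion**: a function continuous on `[a, b]` whose upper symmetric second derivative is `≥ 0` at
  every interior point (`∀ ε > 0`, frequently as `h → 0⁺`, `φ(u+h) + φ(u-h) - 2φ(u) ≥ -εh²`) is
  convex on `[a, b]` (maximum principle for `φ - chord + εx²`).
* `symmDiff_taylor` — Peano form of the symmetric second difference of a comparison function `G`
  with `G' = g` near `u` and `g'(u) = d`: `G(u+h) + G(u-h) - 2G(u) = d h² + o(h²)`.
* `rightDeriv_add_le_leftDeriv_add` — **derivative drop**: if the concave `R` has, at every
  `u ∈ (s, s₀)`, the pointwise bound `R(u+h) + R(u-h) - 2R(u) ≥ -(2K(u) + ε)h²` and `G' = g`,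
  `g' = 2K`, then `R + G` is convex on `[s, s₀]`, whence `R'₊(s) + g(s) ≤ R'₋(s₀) + g(s₀)`: the
  derivative of `R` drops over `[s, s₀]` by at most `∫_s^{s₀} 2K`.

The bootstrap over the condensed rewards and the chord inequality are in the sequel
`BECRewardDescentWalkGlueBootstrap.lean`.

References: Hellmann–Feynman / Griffiths' lemma for concave ground-state energies [Griffiths1966];
second-order perturbation bounds [Kato1966]; route text of BECRewardDescent, item WalkGlue.
-/

noncomputable section

open Set Filter Topology

namespace Summit.AtomisticToContinuum.BoseEinsteinCondensation.Theorems.WalkGlue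

/-! ### A generalised Schwarz convexity criterion -/

/-- **Maximum principle, strict form.** If `ψ` is continuous on `[a,b]` and at every interior point
the second symmetric difference is positive for arbitrarily small increments, then `ψ` is convex on
`[a,b]`: otherwise `ψ - chord` has a positive interior maximum, where all small second symmetric
differences are `≤ 0`. [folklore] -/
theorem convexOn_Icc_of_symmDiff_pos {ψ : ℝ → ℝ} {a b : ℝ} (hψ : ContinuousOn ψ (Icc a b))
    (h2 : ∀ u ∈ Ioo a b, ∃ᶠ h in 𝓝[>] (0 : ℝ), 0 < ψ (u + h) + ψ (u - h) - 2 * ψ u) :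
    ConvexOn ℝ (Icc a b) ψ := by
  refine LinearOrder.convexOn_of_lt (convex_Icc a b) ?_
  intro x hx y hy hxy p q hp hq hpq
  simp only [smul_eq_mul]
  by_contra hcon
  push Not at hcon
  have hyx : 0 < y - x := sub_pos.2 hxy
  have hp' : p = 1 - q := by linarith
  -- the affine interpolant through `(x, ψ x)` and `(y, ψ y)`
  set ℓ : ℝ → ℝ := fun t => ψ x + (ψ y - ψ x) * ((t - x) / (y - x)) with hℓ
  have hℓx : ℓ x = ψ x := by simp [hℓ]
  have hℓy : ℓ y = ψ y := by
    simp only [hℓ, div_self hyx.ne']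
    ring
  have hℓz : ℓ (p * x + q * y) = p * ψ x + q * ψ y := by
    have : (p * x + q * y - x) / (y - x) = q := by
      rw [div_eq_iff hyx.ne', hp']
      ring
    show ψ x + (ψ y - ψ x) * ((p * x + q * y - x) / (y - x)) = p * ψ x + q * ψ y
    rw [this, hp']
    ring
  have haff : ∀ c h : ℝ, ℓ (c + h) + ℓ (c - h) = 2 * ℓ c := by
    intro c h
    simp only [hℓ]
    ring
  set F : ℝ → ℝ := fun t => ψ t - ℓ t with hF
  have hℓcont : Continuous ℓ := by
    simp only [hℓ]
    fun_prop
  have hFcont : ContinuousOn F (Icc x y) :=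
    (hψ.mono (Icc_subset_Icc hx.1 hy.2)).sub hℓcont.continuousOn
  obtain ⟨c, hc, hcmax⟩ := isCompact_Icc.exists_isMaxOn (nonempty_Icc.2 hxy.le) hFcont
  rw [isMaxOn_iff] at hcmax
  have hzx : x < p * x + q * y := by
    have : p * x + q * y - x = q * (y - x) := by rw [hp']; ring
    nlinarith [mul_pos hq hyx]
  have hzy : p * x + q * y < y := by
    have : y - (p * x + q * y) = p * (y - x) := by rw [hp']; ring
    nlinarith [mul_pos hp hyx]
  have hFz : 0 < F (p * x + q * y) := by
    simp only [hF, hℓz]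
    linarith
  have hFc : 0 < F c := hFz.trans_le (hcmax _ ⟨hzx.le, hzy.le⟩)
  have hcx : c ≠ x := by
    intro h
    rw [h] at hFc
    simp [hF, hℓx] at hFc
  have hcy : c ≠ y := by
    intro h
    rw [h] at hFc
    simp [hF, hℓy] at hFc
  have hc' : c ∈ Ioo x y := ⟨lt_of_le_of_ne hc.1 (Ne.symm hcx), lt_of_le_of_ne hc.2 hcy⟩
  have hcab : c ∈ Ioo a b := ⟨hx.1.trans_lt hc'.1, hc'.2.trans_le hy.2⟩
  have hev : ∀ᶠ h in 𝓝[>] (0 : ℝ), ψ (c + h) + ψ (c - h) - 2 * ψ c ≤ 0 := by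
    have hr : 0 < min (c - x) (y - c) := lt_min (sub_pos.2 hc'.1) (sub_pos.2 hc'.2)
    filter_upwards [Ioo_mem_nhdsGT hr] with h hh
    have hh1 : h < c - x := hh.2.trans_le (min_le_left _ _)
    have hh2 : h < y - c := hh.2.trans_le (min_le_right _ _)
    have e1 := hcmax (c + h) ⟨by linarith [hh.1, hc'.1], by linarith⟩
    have e2 := hcmax (c - h) ⟨by linarith, by linarith [hh.1, hc'.2]⟩
    simp only [hF] at e1 e2
    linarith [haff c h]
  obtain ⟨h, hh⟩ := ((h2 c hcab).and_eventually hev).exists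
  exact (hh.1.trans_le hh.2).false

/-- **Generalised Schwarz convexity criterion.** A function continuous on `[a,b]` whose upper
symmetric second derivative is non-negative at every interior point — for every `ε > 0`, frequently
as `h → 0⁺`, `φ(u+h) + φ(u-h) - 2φ(u) ≥ -εh²` — is convex on `[a,b]` (apply the strict form to
`φ + εx²` and let `ε → 0`). [folklore] -/
theorem convexOn_Icc_of_symmDiff {φ : ℝ → ℝ} {a b : ℝ} (hφ : ContinuousOn φ (Icc a b))
    (h2 : ∀ u ∈ Ioo a b, ∀ ε : ℝ, 0 < ε →
      ∃ᶠ h in 𝓝[>] (0 : ℝ), -(ε * h ^ 2) ≤ φ (u + h) + φ (u - h) - 2 * φ u) :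
    ConvexOn ℝ (Icc a b) φ := by
  have hε : ∀ ε : ℝ, 0 < ε → ConvexOn ℝ (Icc a b) (fun t => φ t + ε * t ^ 2) := by
    intro ε hε
    refine convexOn_Icc_of_symmDiff_pos (hφ.add (by fun_prop)) fun u hu => ?_
    have hev : ∀ᶠ h in 𝓝[>] (0 : ℝ), 0 < h := self_mem_nhdsWithin
    refine ((h2 u hu ε hε).and_eventually hev).mono fun h hh => ?_
    have hid : (φ (u + h) + ε * (u + h) ^ 2) + (φ (u - h) + ε * (u - h) ^ 2) -
        2 * (φ u + ε * u ^ 2) = (φ (u + h) + φ (u - h) - 2 * φ u) + 2 * (ε * h ^ 2) := by ring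
    rw [hid]
    nlinarith [hh.1, mul_pos hε (sq_pos_of_pos hh.2)]
  refine ⟨convex_Icc a b, fun x hx y hy p q hp hq hpq => ?_⟩
  simp only [smul_eq_mul]
  refine le_of_forall_pos_le_add fun δ hδ => ?_
  set C : ℝ := p * x ^ 2 + q * y ^ 2 - (p * x + q * y) ^ 2 with hC
  have hε' : 0 < δ / (|C| + 1) := div_pos hδ (by positivity)
  have key := (hε _ hε').2 hx hy hp hq hpq
  simp only [smul_eq_mul] at key
  have hb : δ / (|C| + 1) * C ≤ δ := by
    rw [div_mul_eq_mul_div, div_le_iff₀ (by positivity)]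
    nlinarith [le_abs_self C, abs_nonneg C]
  nlinarith [key, hb]

/-! ### The comparison function: Peano form of the symmetric second difference -/

/-- If `G' = g` near `u` and `g'(u) = d`, then `G(u+h) + G(u-h) - 2G(u) = d·h² + o(h²)` as
`h → 0⁺` (mean value inequality applied to `t ↦ G(t) - G(u) - (t-u)g(u) - (t-u)²d/2`). [folklore] -/
theorem symmDiff_taylor {G g : ℝ → ℝ} {u d : ℝ} (hG : ∀ᶠ t in 𝓝 u, HasDerivAt G (g t) t)
    (hg : HasDerivAt g d u) :
    ∀ ε : ℝ, 0 < ε → ∀ᶠ h in 𝓝[>] (0 : ℝ),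
      |G (u + h) + G (u - h) - 2 * G u - d * h ^ 2| ≤ ε * h ^ 2 := by
  intro ε hε
  have h1 : ∀ᶠ t in 𝓝 u, |g t - g u - (t - u) * d| ≤ ε / 2 * |t - u| := by
    have := (hasDerivAt_iff_isLittleO.1 hg).def (half_pos hε)
    filter_upwards [this] with t ht
    simpa [Real.norm_eq_abs, smul_eq_mul] using ht
  obtain ⟨r, hr, hball⟩ : ∃ r > 0, ∀ t : ℝ, |t - u| < r →
      HasDerivAt G (g t) t ∧ |g t - g u - (t - u) * d| ≤ ε / 2 * |t - u| := by
    obtain ⟨r, hr, h⟩ := Metric.eventually_nhds_iff.1 (hG.and h1)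
    exact ⟨r, hr, fun t ht => h (by simpa [Real.dist_eq] using ht)⟩
  filter_upwards [Ioo_mem_nhdsGT hr] with h hh
  set e : ℝ → ℝ := fun t => G t - G u - (t - u) * g u - (t - u) ^ 2 * d / 2 with he
  have hderiv : ∀ t : ℝ, |t - u| < r → HasDerivAt e (g t - g u - (t - u) * d) t := by
    intro t ht
    have hGt := (hball t ht).1
    have h' : HasDerivAt (fun t => G t - G u - (t - u) * g u - (t - u) ^ 2 * d / 2)
        (g t - 0 - 1 * g u - (2 : ℕ) * (t - u) ^ (2 - 1) * 1 * d / 2) t := by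
      refine ((hGt.sub (hasDerivAt_const t (G u))).sub
        (((hasDerivAt_id t).sub_const u).mul_const (g u))).sub ?_
      exact ((((hasDerivAt_id t).sub_const u).pow 2).mul_const d).div_const 2
    convert h' using 1
    push_cast
    ring
  have hsub : Icc (u - h) (u + h) ⊆ {t | |t - u| < r} := by
    intro t ht
    have : |t - u| ≤ h := abs_sub_le_iff.2 ⟨by linarith [ht.2], by linarith [ht.1]⟩
    exact this.trans_lt hh.2
  have hMVT : ∀ t ∈ Icc (u - h) (u + h), ‖e t - e u‖ ≤ (ε / 2 * h) * ‖t - u‖ := by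
    intro t ht
    refine (convex_Icc (u - h) (u + h)).norm_image_sub_le_of_norm_hasDerivWithin_le
      (fun s hs => (hderiv s (hsub hs)).hasDerivWithinAt) (fun s hs => ?_)
      ⟨by linarith [hh.1], by linarith [hh.1]⟩ ht
    have hs' : |s - u| ≤ h := abs_sub_le_iff.2 ⟨by linarith [hs.2], by linarith [hs.1]⟩
    rw [Real.norm_eq_abs]
    calc |g s - g u - (s - u) * d| ≤ ε / 2 * |s - u| := (hball s (hsub hs)).2
      _ ≤ ε / 2 * h := by gcongr
  have heu : e u = 0 := by simp [he]
  have e1 := hMVT (u + h) ⟨by linarith [hh.1], le_rfl⟩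
  have e2 := hMVT (u - h) ⟨le_rfl, by linarith [hh.1]⟩
  rw [heu, sub_zero, Real.norm_eq_abs, Real.norm_eq_abs] at e1 e2
  have ha1 : |u + h - u| = h := by rw [add_sub_cancel_left, abs_of_pos hh.1]
  have ha2 : |u - h - u| = h := by rw [sub_sub_cancel_left, abs_neg, abs_of_pos hh.1]
  rw [ha1] at e1
  rw [ha2] at e2
  have hid : G (u + h) + G (u - h) - 2 * G u - d * h ^ 2 = e (u + h) + e (u - h) := by
    simp only [he]
    ring
  rw [hid]
  calc |e (u + h) + e (u - h)| ≤ |e (u + h)| + |e (u - h)| := abs_add_le _ _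
    _ ≤ ε / 2 * h * h + ε / 2 * h * h := add_le_add e1 e2
    _ = ε * h ^ 2 := by ring


/-! ### One-sided derivatives of a concave function on `[0, ∞)` -/

/-- A concave function on `[0,∞)` is right-differentiable at every `u > 0`. [folklore] -/
theorem differentiableWithinAt_Ioi_of_concaveOn {R : ℝ → ℝ} (hR : ConcaveOn ℝ (Ici 0) R) {u : ℝ}
    (hu : 0 < u) : DifferentiableWithinAt ℝ R (Ioi u) u := by
  have h := hR.neg.differentiableWithinAt_Ioi_of_mem_interior (by rw [interior_Ici]; exact hu)
  exact differentiableWithinAt_neg_iff.1 h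

/-- A concave function on `[0,∞)` is left-differentiable at every `u > 0`. [folklore] -/
theorem differentiableWithinAt_Iio_of_concaveOn {R : ℝ → ℝ} (hR : ConcaveOn ℝ (Ici 0) R) {u : ℝ}
    (hu : 0 < u) : DifferentiableWithinAt ℝ R (Iio u) u := by
  have h := hR.neg.differentiableWithinAt_Iio_of_mem_interior (by rw [interior_Ici]; exact hu)
  exact differentiableWithinAt_neg_iff.1 h

/-- A concave function on `[0,∞)` is continuous on `(0,∞)`. [folklore] -/
theorem continuousOn_Ioi_of_concaveOn {R : ℝ → ℝ} (hR : ConcaveOn ℝ (Ici 0) R) :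
    ContinuousOn R (Ioi 0) := by
  have := hR.continuousOn_interior
  rwa [interior_Ici] at this

/-! ### The derivative drop from the pointwise second-order bound -/

/-- **Derivative drop.** Let `R` be concave on `[0,∞)` and `0 < s < s₀`. Suppose that at every
`u ∈ (s, s₀)` and for every `ε > 0` the second symmetric difference of `R` is, frequently as `h → 0⁺`,
at least `-(2K(u) + ε)h²`, and that `G' = g` on `[s, s₀]`, `g' = 2K` on `(s, s₀)`. Then `R + G` is
convex on `[s, s₀]`, and consequently the right derivative of `R` at `s` exceeds its left derivative
at `s₀` by at most `g(s₀) - g(s)` (= `∫_s^{s₀} 2K`): the integrated form of `-R'' ≤ 2K`. [folklore] -/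
theorem rightDeriv_add_le_leftDeriv_add {R G g K : ℝ → ℝ} {s s₀ : ℝ}
    (hR : ConcaveOn ℝ (Ici 0) R) (hs : 0 < s) (hss₀ : s < s₀)
    (hG : ∀ u ∈ Icc s s₀, HasDerivAt G (g u) u)
    (hg : ∀ u ∈ Ioo s s₀, HasDerivAt g (2 * K u) u)
    (hloc : ∀ u ∈ Ioo s s₀, ∀ ε : ℝ, 0 < ε →
      ∃ᶠ h in 𝓝[>] (0 : ℝ), -((2 * K u + ε) * h ^ 2) ≤ R (u + h) + R (u - h) - 2 * R u) :
    derivWithin R (Ioi s) s + g s ≤ derivWithin R (Iio s₀) s₀ + g s₀ := by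
  set φ : ℝ → ℝ := fun t => R t + G t with hφ
  have hRcont := continuousOn_Ioi_of_concaveOn hR
  have hφcont : ContinuousOn φ (Icc s s₀) :=
    (hRcont.mono fun u hu => hs.trans_le hu.1).add
      fun u hu => (hG u hu).continuousAt.continuousWithinAt
  have hconv : ConvexOn ℝ (Icc s s₀) φ := by
    refine convexOn_Icc_of_symmDiff hφcont fun u hu ε hε => ?_
    have hGu : ∀ᶠ t in 𝓝 u, HasDerivAt G (g t) t := by
      filter_upwards [Ioo_mem_nhds hu.1 hu.2] with t ht using hG t (Ioo_subset_Icc_self ht)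
    have hB := symmDiff_taylor hGu (hg u hu) (ε / 2) (half_pos hε)
    refine ((hloc u hu (ε / 2) (half_pos hε)).and_eventually hB).mono fun h hh => ?_
    have h2 := (abs_le.1 hh.2).1
    have hid : φ (u + h) + φ (u - h) - 2 * φ u =
        (R (u + h) + R (u - h) - 2 * R u) + (G (u + h) + G (u - h) - 2 * G u) := by
      simp only [hφ]
      ring
    rw [hid]
    nlinarith [hh.1, h2]
  have hRr : DifferentiableWithinAt ℝ R (Ioi s) s := differentiableWithinAt_Ioi_of_concaveOn hR hs
  have hRl : DifferentiableWithinAt ℝ R (Iio s₀) s₀ :=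
    differentiableWithinAt_Iio_of_concaveOn hR (hs.trans hss₀)
  have hφr : HasDerivWithinAt φ (derivWithin R (Ioi s) s + g s) (Ioi s) s :=
    hRr.hasDerivWithinAt.add (hG s ⟨le_rfl, hss₀.le⟩).hasDerivWithinAt
  have hφl : HasDerivWithinAt φ (derivWithin R (Iio s₀) s₀ + g s₀) (Iio s₀) s₀ :=
    hRl.hasDerivWithinAt.add (hG s₀ ⟨hss₀.le, le_rfl⟩).hasDerivWithinAt
  have h1 := hconv.rightDeriv_le_slope (left_mem_Icc.2 hss₀.le) (right_mem_Icc.2 hss₀.le) hss₀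
    hφr.differentiableWithinAt
  have h2 := hconv.slope_le_leftDeriv (left_mem_Icc.2 hss₀.le) (right_mem_Icc.2 hss₀.le) hss₀
    hφl.differentiableWithinAt
  rw [hφr.derivWithin (uniqueDiffWithinAt_Ioi s)] at h1
  rw [hφl.derivWithin (uniqueDiffWithinAt_Iio s₀)] at h2
  exact h1.trans h2

end Summit.AtomisticToContinuum.BoseEinsteinCondensation.Theorems.WalkGlue

end
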